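import Mathlib

/-!
# v6 «SuzukiWindowsDoorConverse» — L6: an eigenfunction's image vanishes beyond the window

RH-FREE, ζ-FREE real analysis.  If `g` is continuous, `g = ε f` a.e. on `s = (−t,t)` (`ε = ±1`), and the weighted
contraction bound `∫_ℝ g² e^{−2cx} dx ≤ ∫_s f² e^{2cy} dy` holds for every `c ∈ (0,1/2]` (module PlancherelBound), then
`g = 0` on `(t, ∞)`: the mass of `g` outside the window is squeezed to `0` as `c → 0⁺`.  Nothing here bears on RH.
-/

set_option linter.dupNamespace false

open MeasureTheory Set Filter Topology

namespace Summit.RiemannHypothesis.RiemannHypothesis.Theorems.SuzukiWindowsDoorConverse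

/-- RH-FREE (L6): vanishing of the image beyond the window. -/
theorem eq_zero_beyond_window {g f : ℝ → ℝ} (hgc : Continuous g) {t ε : ℝ} (hε : ε = 1 ∨ ε = -1)
    (hf : MemLp f 2 (volume.restrict (Ioo (-t) t)))
    (heig : ∀ᵐ x ∂(volume.restrict (Ioo (-t) t)), g x = ε * f x)
    (hL5 : ∀ c : ℝ, 0 < c → c ≤ 1 / 2 →
      Integrable (fun x : ℝ => g x ^ 2 * Real.exp (-(2 * c) * x)) ∧
        ∫ x : ℝ, g x ^ 2 * Real.exp (-(2 * c) * x) ≤ ∫ y in Ioo (-t) t, f y ^ 2 * Real.exp (2 * c * y)) :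
    ∀ x : ℝ, t < x → g x = 0 := by
  set s : Set ℝ := Ioo (-t) t with hs_def
  have hs : MeasurableSet s := measurableSet_Ioo
  haveI : IsFiniteMeasure (volume.restrict s) := by rw [hs_def]; infer_instance
  have hε2 : ε ^ 2 = 1 := by rcases hε with h | h <;> simp [h]
  have hf2 : Integrable (fun y => f y ^ 2) (volume.restrict s) := hf.integrable_sq
  set B : ℝ := ∫ y in s, f y ^ 2 with hB_def
  intro x₀ hx₀
  by_contra hgx₀
  set T : ℝ := x₀ + 1 with hT_def
  set U : Set ℝ := Ioo t T with hU_def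
  have hU : MeasurableSet U := measurableSet_Ioo
  have hx₀U : x₀ ∈ U := ⟨hx₀, by simp [hT_def]⟩
  have htT : t < T := by have := hx₀; simp [hT_def]; linarith
  -- J := ∫_U g² > 0
  have hφc : Continuous fun x => g x ^ 2 := hgc.pow 2
  have hJint : IntegrableOn (fun x => g x ^ 2) U volume :=
    (hφc.integrableOn_Icc (a := t) (b := T)).mono_set Ioo_subset_Icc_self
  set J : ℝ := ∫ x in U, g x ^ 2 with hJ_def
  have hJpos : 0 < J := by
    rw [hJ_def, setIntegral_pos_iff_support_of_nonneg_ae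
      (Eventually.of_forall fun x => by positivity) hJint]
    have hopen : IsOpen (Function.support (fun x => g x ^ 2) ∩ U) :=
      (isOpen_ne_fun hφc continuous_const).inter isOpen_Ioo
    exact hopen.measure_pos volume ⟨x₀, by simpa [Function.mem_support] using hgx₀, hx₀U⟩
  -- the squeeze: J ≤ e^{2cT} (e^{2ct} - e^{-2ct}) B for every c ∈ (0, 1/2]
  have hsqueeze : ∀ c : ℝ, 0 < c → c ≤ 1 / 2 →
      J ≤ Real.exp (2 * c * T) * (Real.exp (2 * c * t) - Real.exp (-(2 * c * t))) * B := by
    intro c hc hc1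
    obtain ⟨hInt, hle⟩ := hL5 c hc hc1
    have hφnn : ∀ x, 0 ≤ g x ^ 2 * Real.exp (-(2 * c) * x) := fun x => by positivity
    -- (A) ∫_s φ + ∫_U φ ≤ ∫ φ
    have hdisj : Disjoint s U := by
      rw [hs_def, hU_def, Set.disjoint_iff]
      rintro x ⟨⟨_, h1⟩, ⟨h2, _⟩⟩; exact absurd h1 (not_lt.2 h2.le)
    have hA1 : ∫ x in s ∪ U, g x ^ 2 * Real.exp (-(2 * c) * x) =
        (∫ x in s, g x ^ 2 * Real.exp (-(2 * c) * x)) + ∫ x in U, g x ^ 2 * Real.exp (-(2 * c) * x) :=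
      setIntegral_union hdisj hU hInt.integrableOn hInt.integrableOn
    have hA2 : ∫ x in s ∪ U, g x ^ 2 * Real.exp (-(2 * c) * x) ≤ ∫ x, g x ^ 2 * Real.exp (-(2 * c) * x) :=
      setIntegral_le_integral hInt (Eventually.of_forall hφnn)
    -- (B) ∫_s φ = ∫_s f² e^{-2cy}
    have hB : ∫ x in s, g x ^ 2 * Real.exp (-(2 * c) * x) = ∫ y in s, f y ^ 2 * Real.exp (-(2 * c) * y) := by
      refine integral_congr_ae ?_
      filter_upwards [heig] with x hx
      simp only [hx, mul_pow, hε2, one_mul]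
    -- (C) e^{-2cT} J ≤ ∫_U φ
    have hC : Real.exp (-(2 * c) * T) * J ≤ ∫ x in U, g x ^ 2 * Real.exp (-(2 * c) * x) := by
      rw [hJ_def, ← integral_const_mul]
      refine setIntegral_mono_on (hJint.const_mul _) hInt.integrableOn hU fun x hx => ?_
      rw [mul_comm]
      refine mul_le_mul_of_nonneg_left (Real.exp_le_exp.2 ?_) (by positivity)
      have := hx.2; nlinarith
    -- (D) ∫_s f² e^{2cy} - ∫_s f² e^{-2cy} ≤ (e^{2ct} - e^{-2ct}) B
    have hw1 : Integrable (fun y => f y ^ 2 * Real.exp (2 * c * y)) (volume.restrict s) := by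
      have := hf2.bdd_mul (f := fun y => Real.exp (2 * c * y)) (c := Real.exp (2 * c * |t|))
        (by fun_prop : Continuous fun y : ℝ => Real.exp (2 * c * y)).aestronglyMeasurable ?_
      · simpa [mul_comm] using this
      · filter_upwards [ae_restrict_mem hs] with y hy
        rw [Real.norm_of_nonneg (Real.exp_pos _).le]
        refine Real.exp_le_exp.2 ?_
        have : y ≤ |t| := by have := le_abs_self t; have := hy.2; linarith
        nlinarith
    have hw2 : Integrable (fun y => f y ^ 2 * Real.exp (-(2 * c) * y)) (volume.restrict s) := by
      have := hf2.bdd_mul (f := fun y => Real.exp (-(2 * c) * y)) (c := Real.exp (2 * c * |t|))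
        (by fun_prop : Continuous fun y : ℝ => Real.exp (-(2 * c) * y)).aestronglyMeasurable ?_
      · simpa [mul_comm] using this
      · filter_upwards [ae_restrict_mem hs] with y hy
        rw [Real.norm_of_nonneg (Real.exp_pos _).le]
        refine Real.exp_le_exp.2 ?_
        have : -|t| ≤ y := by have := le_abs_self t; have := hy.1; linarith
        nlinarith
    have hD1 : (∫ y in s, f y ^ 2 * Real.exp (2 * c * y)) - ∫ y in s, f y ^ 2 * Real.exp (-(2 * c) * y) =
        ∫ y in s, (f y ^ 2 * Real.exp (2 * c * y) - f y ^ 2 * Real.exp (-(2 * c) * y)) :=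
      (integral_sub hw1 hw2).symm
    have hD2 : ∫ y in s, (f y ^ 2 * Real.exp (2 * c * y) - f y ^ 2 * Real.exp (-(2 * c) * y)) ≤
        ∫ y in s, (Real.exp (2 * c * t) - Real.exp (-(2 * c * t))) * f y ^ 2 := by
      refine setIntegral_mono_on (hw1.sub hw2) (hf2.const_mul _) hs fun y hy => ?_
      have h1 : Real.exp (2 * c * y) ≤ Real.exp (2 * c * t) :=
        Real.exp_le_exp.2 (by have := hy.2; nlinarith)
      have h2 : Real.exp (-(2 * c * t)) ≤ Real.exp (-(2 * c) * y) :=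
        Real.exp_le_exp.2 (by have := hy.2; nlinarith)
      have h3 : 0 ≤ f y ^ 2 := sq_nonneg _
      nlinarith
    have hD3 : ∫ y in s, (Real.exp (2 * c * t) - Real.exp (-(2 * c * t))) * f y ^ 2 =
        (Real.exp (2 * c * t) - Real.exp (-(2 * c * t))) * B := by
      rw [hB_def, integral_const_mul]
    -- combine
    have hmain : Real.exp (-(2 * c) * T) * J ≤ (Real.exp (2 * c * t) - Real.exp (-(2 * c * t))) * B := by
      linarith [hA1, hA2, hB, hC, hD1, hD2, hD3, hle]
    have hexp : Real.exp (2 * c * T) * Real.exp (-(2 * c) * T) = 1 := by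
      rw [← Real.exp_add, show 2 * c * T + -(2 * c) * T = 0 by ring, Real.exp_zero]
    calc J = Real.exp (2 * c * T) * (Real.exp (-(2 * c) * T) * J) := by rw [← mul_assoc, hexp, one_mul]
      _ ≤ Real.exp (2 * c * T) * ((Real.exp (2 * c * t) - Real.exp (-(2 * c * t))) * B) :=
          mul_le_mul_of_nonneg_left hmain (Real.exp_pos _).le
      _ = _ := by ring
  -- let c → 0⁺
  set h : ℝ → ℝ := fun c => Real.exp (2 * c * T) * (Real.exp (2 * c * t) - Real.exp (-(2 * c * t))) * B
    with hh_def
  have hhc : Continuous h := by simp only [hh_def]; fun_prop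
  have hh0 : h 0 = 0 := by simp [hh_def]
  have htend : Tendsto h (𝓝[>] 0) (𝓝 0) := by
    have := (hhc.tendsto 0).mono_left (nhdsWithin_le_nhds (s := Ioi (0 : ℝ)))
    rwa [hh0] at this
  have hev1 : ∀ᶠ c in 𝓝[>] (0 : ℝ), h c < J := htend (Iio_mem_nhds hJpos)
  have hev2 : ∀ᶠ c in 𝓝[>] (0 : ℝ), c ∈ Ioc (0 : ℝ) (1 / 2) := Ioc_mem_nhdsGT (by norm_num)
  obtain ⟨c, hc1, hc2⟩ := (hev1.and hev2).exists
  exact absurd (hsqueeze c hc2.1 hc2.2) (not_le.2 hc1)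

/-- Consequence (RH-FREE): together with the vanishing on `(−∞, −t)` (causality of `K`), the image `g` agrees a.e. on `ℝ`
with the windowed function `1_{(−t,t)} · ε f`. -/
theorem ae_eq_indicator_of_eigen {g f : ℝ → ℝ} {t ε : ℝ}
    (hg0 : ∀ x : ℝ, x < -t → g x = 0) (hg1 : ∀ x : ℝ, t < x → g x = 0)
    (heig : ∀ᵐ x ∂(volume.restrict (Ioo (-t) t)), g x = ε * f x) :
    g =ᵐ[volume] (Ioo (-t) t).indicator fun y => ε * f y := by
  have hs : MeasurableSet (Ioo (-t) t) := measurableSet_Ioo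
  -- on s
  have h_in : ∀ᵐ x ∂volume, x ∈ Ioo (-t) t → g x = ((Ioo (-t) t).indicator fun y => ε * f y) x := by
    rw [← ae_restrict_iff' hs]
    filter_upwards [heig, ae_restrict_mem hs] with x hx hxs
    rw [indicator_of_mem hxs, hx]
  -- off s, except the two endpoints
  have h_out : ∀ᵐ x ∂volume, x ∉ Ioo (-t) t → x ≠ -t → x ≠ t →
      g x = ((Ioo (-t) t).indicator fun y => ε * f y) x := by
    refine Eventually.of_forall fun x hxs h1 h2 => ?_
    rw [indicator_of_notMem hxs]
    rcases lt_or_ge x (-t) with hlt | hge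
    · exact hg0 x hlt
    · have hxt : t < x := by
        rcases lt_or_ge t x with h | h
        · exact h
        · exfalso; apply hxs
          exact ⟨lt_of_le_of_ne hge (Ne.symm h1), lt_of_le_of_ne h h2⟩
      exact hg1 x hxt
  have h_ne1 : ∀ᵐ x ∂(volume : Measure ℝ), x ≠ -t := by
    filter_upwards [compl_mem_ae_iff.2 (measure_singleton (-t) : (volume : Measure ℝ) {(-t : ℝ)} = 0)]
      with x hx
    simpa using hx
  have h_ne2 : ∀ᵐ x ∂(volume : Measure ℝ), x ≠ t := by
    filter_upwards [compl_mem_ae_iff.2 (measure_singleton t : (volume : Measure ℝ) {(t : ℝ)} = 0)]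
      with x hx
    simpa using hx
  filter_upwards [h_in, h_out, h_ne1, h_ne2] with x hin hout hn1 hn2
  by_cases hxs : x ∈ Ioo (-t) t
  · exact hin hxs
  · exact hout hxs hn1 hn2

end Summit.RiemannHypothesis.RiemannHypothesis.Theorems.SuzukiWindowsDoorConverse
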